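import Literature.Analysis.FunctionSpaces.TorusCubeFieldTransfer
import Literature.Analysis.FunctionSpaces.TorusTestFunction
import HarnessLib

/-!
# Planting cube-supported data on the flat torus: tools (theorems only)

Analysis/FunctionSpaces support file (everything proved; no definitions, no named facts),
companion of `TorusPeriodization`, `TorusPeriodizationCube`, `TorusCubeFieldTransfer`. When a
field `g` on `ℝᵈ` vanishing off the open unit cube `(0,1)ᵈ` is read on `Tᵈ = ℝᵈ/ℤᵈ` through its
periodisation `Torus.periodize g` (one lattice term on the fundamental cube), the following
transfer facts are needed by constructions that plant a *rough* object (smooth only away from a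
point) next to smooth ones in a periodic box — here the point-sink scaffold of
`Summits/AnomalousDissipation` (a weak Euler–Reynolds subsolution centred at the cube centre `q`,
plus a smooth stirring cell):

* `Torus.contDiffOn_perSum_comp_add` — smoothness of `v ↦ perSum g (q + v)` ON A SET `A`, from
  smoothness on `A` of every lattice translate `v ↦ g (q + v + k)` (near each point the lattice sum
  is a fixed finite sum; no global smoothness of `g` is required);
* `Torus.liftAt_periodize_proj` — the chart of the periodisation at `proj q` is `v ↦ perSum g (q+v)`;
* `Torus.add_mem_unitCube_of_norm_lt`, `Torus.half_le_norm_sub_of_not_mem_openCube` — the cube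
  centre `q = (½, …, ½)`: `q + v` lies in the open cube for `|v| < ½`, and points off the open cube
  are at distance `≥ ½` from `q`;
* `Torus.memLp_periodize_of_cube`, `Torus.integrable_periodize_of_cube` — `Lᵖ`/`L¹` transfer along
  the measure-preserving section `repr`;
* `Torus.integral_eq_integral_of_forall_proj_eq` — `∫_{Tᵈ} Φ = ∫_{ℝᵈ} Ψ` when `Φ ∘ proj = Ψ` on
  the fundamental cube and `Ψ = 0` off it;
* `Torus.isDivFree_periodize_of_cube` (time-independent form of `isDivFree_periodize_slice`),
  `Torus.partialDeriv_apply_eq_fderiv_apply` — torus partial derivatives in coordinates (the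
  divergence in coordinates is the landed `VortexSheet.divergence_eq_sum_fderiv`, not restated).

## References

* L. Grafakos, *Classical Fourier Analysis*, 3rd ed. (2014), §3.1.1 (periodisation, the fundamental
  cube).
* E. Bruè, C. De Lellis, Comm. Math. Phys. 400 (2023), §5 (cube-supported fields read on the
  torus).
-/

noncomputable section

open MeasureTheory Set Function Filter Metric
open scoped ContDiff InnerProductSpace Topology

namespace Literature.Analysis.FunctionSpaces

namespace Torus

variable {d : Type*} [Fintype d] [DecidableEq d]
variable {F : Type*} [NormedAddCommGroup F] [NormedSpace ℝ F]

/-! ## Smoothness of the periodisation on a set -/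

/-- **Smoothness of a lattice sum on a set.** Let `g` have bounded support. If every lattice
translate `v ↦ g (q + v + k)` is `Cⁿ` on a set `A`, then so is `v ↦ perSum g (q + v)`: near each
point the lattice sum is a fixed finite sum of translates (`perSum_eventuallyEq_sum`). No global
regularity of `g` is assumed (the intended `g` is smooth only away from a lattice of points).
[folklore] -/
theorem contDiffOn_perSum_comp_add {n : WithTop ℕ∞} {g : EuclideanSpace ℝ d → F} {R : ℝ}
    (hg : support g ⊆ closedBall 0 R) (q : EuclideanSpace ℝ d) {A : Set (EuclideanSpace ℝ d)}
    (h : ∀ k : d → ℤ, ContDiffOn ℝ n (fun v => g (q + v + latticeVec k)) A) :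
    ContDiffOn ℝ n (fun v => perSum g (q + v)) A := by
  intro v hv
  obtain ⟨m, hm⟩ := exists_nat_ge (R + (‖q + v‖ + 1))
  have hev : (fun v => perSum g (q + v)) =ᶠ[𝓝 v]
      fun v => ∑ k ∈ latticeWindow d m, g (q + v + latticeVec k) := by
    have h1 := perSum_eventuallyEq_sum hg (q + v) hm
    have ht : Tendsto (fun v : EuclideanSpace ℝ d => q + v) (𝓝 v) (𝓝 (q + v)) :=
      (continuous_const.add continuous_id).tendsto v
    exact ht.eventually h1
  exact (ContDiffWithinAt.sum fun k _ => h k v hv).congr_of_eventuallyEq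
    (hev.filter_mono nhdsWithin_le_nhds) hev.eq_of_nhds

omit [DecidableEq d] in
/-- The chart at `proj q` of the periodisation is the translated lattice sum:
`liftAt (periodize g) (proj q) v = perSum g (q + v)`. [folklore] -/
theorem liftAt_periodize_proj [DecidableEq d] {G : Type*} [AddCommMonoid G] [TopologicalSpace G]
    (g : EuclideanSpace ℝ d → G) (q : EuclideanSpace ℝ d) :
    liftAt (periodize g) (proj q) = fun v => perSum g (q + v) := by
  funext v
  rw [liftAt_apply, ← proj_add, periodize_proj]

/-! ## The cube centre -/

omit [DecidableEq d] in
/-- Coordinates are bounded by the Euclidean norm: `|v i| ≤ ‖v‖` (private copy of the tree's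
`Torus.abs_apply_le_norm`, `TorusMollifier`, not imported to keep the import graph light).
[folklore] -/
private theorem abs_apply_le_norm' (v : EuclideanSpace ℝ d) (i : d) : |v i| ≤ ‖v‖ := by
  have h := PiLp.norm_apply_le v i
  rwa [Real.norm_eq_abs] at h

omit [DecidableEq d] in
/-- Around the cube centre `q = (½, …, ½)`: for `‖v‖ < ½` the point `q + v` lies in the open unit
cube (hence in the fundamental cube `[0,1)ᵈ`). [folklore] -/
theorem add_mem_unitCube_of_norm_lt {q v : EuclideanSpace ℝ d} (hq : ∀ i, q i = 1 / 2)
    (hv : ‖v‖ < 1 / 2) : q + v ∈ unitCube d ∧ ∀ i, (q + v) i ∈ Ioo (0 : ℝ) 1 := by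
  have hi : ∀ i, (q + v) i ∈ Ioo (0 : ℝ) 1 := fun i => by
    have h1 := abs_apply_le_norm' v i
    rw [abs_le] at h1
    simp only [PiLp.add_apply, hq i, mem_Ioo]
    constructor <;> linarith
  exact ⟨fun i => Ioo_subset_Ico_self (hi i), hi⟩

omit [DecidableEq d] in
/-- Points off the open unit cube are at distance at least `½` from the centre
`q = (½, …, ½)`. [folklore] -/
theorem half_le_norm_sub_of_not_mem_openCube {q y : EuclideanSpace ℝ d} (hq : ∀ i, q i = 1 / 2)
    (hy : ¬ ∀ i, y i ∈ Ioo (0 : ℝ) 1) : 1 / 2 ≤ ‖y - q‖ := by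
  push Not at hy
  obtain ⟨i, hi⟩ := hy
  refine le_trans ?_ (abs_apply_le_norm' (y - q) i)
  rw [PiLp.sub_apply, hq i]
  rw [mem_Ioo, not_and_or, not_lt, not_lt] at hi
  rcases hi with h | h
  · rw [abs_of_nonpos (by linarith)]
    linarith
  · rw [abs_of_nonneg (by linarith)]
    linarith

/-- Points of the lattice-distance set `{v | ∀ w, proj w = 0 → r < ‖v - w‖}` are at distance `> r`
from every lattice vector: `r < ‖v + latticeVec k‖`. [folklore] -/
theorem lt_norm_add_latticeVec_of_forall {r : ℝ} {v : EuclideanSpace ℝ d}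
    (hv : ∀ w : EuclideanSpace ℝ d, proj w = 0 → r < ‖v - w‖) (k : d → ℤ) :
    r < ‖v + latticeVec k‖ := by
  have h := hv (-latticeVec k) (by rw [proj_neg, proj_latticeVec, neg_zero])
  rwa [sub_neg_eq_add] at h

/-! ## Integrability transfer along `repr` -/

omit [NormedSpace ℝ F] in
/-- **`Lᵖ` transfer.** If `g ∈ Lᵖ(ℝᵈ)` vanishes off the open unit cube then its periodisation is in
`Lᵖ(Tᵈ)` (`periodize g = g ∘ repr` and `repr` is measure preserving onto the cube). [folklore] -/
theorem memLp_periodize_of_cube {g : EuclideanSpace ℝ d → F}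
    (hg0 : ∀ y, (¬ ∀ i, y i ∈ Ioo (0 : ℝ) 1) → g y = 0) {p : ENNReal} (hg : MemLp g p volume) :
    MemLp (periodize g) p (volume : Measure (UnitAddTorus d)) := by
  have h : periodize g = g ∘ repr := funext (periodize_eq_apply_repr hg0)
  rw [h]
  exact (hg.restrict (unitCube d)).comp_measurePreserving measurePreserving_repr

omit [NormedSpace ℝ F] in
/-- **`L¹` transfer.** If `g ∈ L¹(ℝᵈ)` vanishes off the open unit cube then its periodisation is
integrable on `Tᵈ`. [folklore] -/
theorem integrable_periodize_of_cube {g : EuclideanSpace ℝ d → F}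
    (hg0 : ∀ y, (¬ ∀ i, y i ∈ Ioo (0 : ℝ) 1) → g y = 0) (hg : Integrable g volume) :
    Integrable (periodize g) (volume : Measure (UnitAddTorus d)) := by
  have h : periodize g = g ∘ repr := funext (periodize_eq_apply_repr hg0)
  rw [h]
  exact (measurePreserving_repr.integrable_comp
    (hg.integrableOn (s := unitCube d)).aestronglyMeasurable).2 hg.integrableOn

omit [DecidableEq d] in
/-- **Integral transfer.** If `Φ ∘ proj = Ψ` on the fundamental cube and `Ψ = 0` off it, then
`∫_{Tᵈ} Φ = ∫_{ℝᵈ} Ψ` (unconditionally: `∫_{Tᵈ} Φ = ∫_{[0,1)ᵈ} Φ ∘ proj`). [folklore] -/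
theorem integral_eq_integral_of_forall_proj_eq {Φ : UnitAddTorus d → F}
    {Ψ : EuclideanSpace ℝ d → F} (h1 : ∀ y ∈ unitCube d, Φ (proj y) = Ψ y)
    (h2 : ∀ y, y ∉ unitCube d → Ψ y = 0) : ∫ x, Φ x = ∫ y, Ψ y := by
  classical
  rw [integral_eq_integral_lift_holds Φ, ← setIntegral_eq_integral_of_forall_compl_eq_zero h2]
  exact setIntegral_congr_fun measurableSet_unitCube fun y hy => h1 y hy

/-! ## Divergence on the torus in coordinates -/

/-- Time-independent form of `isDivFree_periodize_slice`: a smooth divergence-free field on `ℝᵈ`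
vanishing off a closed subset of the open unit cube periodises to a divergence-free field on `Tᵈ`.
[folklore] -/
theorem isDivFree_periodize_of_cube {g : EuclideanSpace ℝ d → EuclideanSpace ℝ d}
    (hg : ContDiff ℝ ∞ g) {K : Set (EuclideanSpace ℝ d)} (hK : IsClosed K)
    (hKsub : K ⊆ {y | ∀ i, y i ∈ Ioo (0 : ℝ) 1}) (h0 : ∀ y ∉ K, g y = 0)
    (hdiv : ∀ z, LinearMap.trace ℝ (EuclideanSpace ℝ d)
      (_root_.fderiv ℝ g z : EuclideanSpace ℝ d →ₗ[ℝ] EuclideanSpace ℝ d) = 0) :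
    IsDivFree (periodize g) :=
  isDivFree_periodize_slice (u := fun _ : ℝ => g) (S := univ)
    ((hg.comp contDiff_snd).contDiffOn) hK hKsub (fun _ _ y hy => h0 y hy) (mem_univ (0 : ℝ)) hdiv

/-- Coordinates of the torus partial derivatives of a `C¹` field: `(∂ⱼ w)ᵢ (x) = (Dw(x) eⱼ)ᵢ`.
[folklore] -/
theorem partialDeriv_apply_eq_fderiv_apply {w : UnitAddTorus d → EuclideanSpace ℝ d}
    (hw : IsContDiff 1 w) (i j : d) (x : UnitAddTorus d) :
    partialDeriv j w x i = Torus.fderiv w x (EuclideanSpace.single j 1) i := by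
  rw [partialDeriv_eq_fderiv_apply hw]

end Torus

end Literature.Analysis.FunctionSpaces
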